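/-
Fleet lead `ym-wcr-19609-p1` (seat prover-ym-wcr-19609-p1-g2-0), route `WeakCouplingRates`, crux `BulkDominatesColdBoxW`
(stmt-QuantumFields-19609), line `dlr-chessboard` (skeleton v6 `3b7126b18e0d2b7e`): registered stub `stub_flatCovExpansion`, BY NAME.
-/
import Summits.QuantumFields.YangMills.Theorems.WeakCouplingRatesBulkDominatesColdBoxWFlatCovOfDomAbs
import Summits.QuantumFields.YangMills.Theorems.WeakCouplingRatesColdBoxTwoPointFloorWStubBoxGaussianDomination

/-!
# Crux `BulkDominatesColdBoxW`, line `dlr-chessboard`: the registered stub `stub_flatCovExpansion` — CLOSED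

`stub_flatCovExpansion : ∃ θ₂ > 0, ∀ θ, 0 < θ → θ ≤ θ₂ → FlatCovExpansion (θ/20) θ` (skeleton v6 of crux stmt-QuantumFields-19609) is the sibling crux's
absolute Dirichlet domination `boxDirichletDominationAbs` (seat ym-wcr-19456-p1, `…ColdBoxTwoPointFloorWStubBoxGaussianDomination`, θ₀ = 1/100, κ = 9θ)
pushed through the bridge `flatCovExpansion_of_domAbs` (`…BulkDominatesColdBoxWFlatCovOfDomAbs`).  No new definition; standard axioms.
NOT a claim about the mass gap.
-/

set_option autoImplicit false

noncomputable section

namespace Summit.QuantumFields.YangMills.Theorems.WeakCouplingRates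

/-- **Registered stub `stub_flatCovExpansion` of crux `BulkDominatesColdBoxW` (line dlr-chessboard, v6)**: for all small `θ` the flat one-scale
covariance expansion `FlatCovExpansion (θ/20) θ` holds. -/
theorem stub_flatCovExpansion : ∃ θ₂ : ℝ, 0 < θ₂ ∧ ∀ θ : ℝ, 0 < θ → θ ≤ θ₂ → FlatCovExpansion (θ / 20) θ :=
  flatCovExpansion_of_domAbs boxDirichletDominationAbs

end Summit.QuantumFields.YangMills.Theorems.WeakCouplingRates

end
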